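import Literature.Probability.Percolation.ArmSeparationRawGood
import Literature.Probability.Percolation.TriLowestCrossingObstruction
import HarnessLib

/-!
# The fence of a term with a stopping set: the data and its planar position

Topic `Literature/Probability/Percolation`; family `crit-perc` / near-critical percolation on `𝕋`.
A brick of the near-critical arm-separation theorem for four arms in the ADJACENT colour
arrangement (P. Nolin, EJP 13 (2008), Thm. 11, `j = 4`, `σ = BBWW` [arXiv 0711.4948: Thm. 10];
the last missing input `hsepAdj` of `Werner2009_lemma63_of_altSeparation_of_adjSeparation`).

For the rerouting of two arms of the same colour along the exploration sequence of the trapezoid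
behind side `0` of `∂Λ_{2M}` (Nolin 2008, §4.4, proof of Lemma 15, last paragraph; organised in
the tree through Menger's theorem), every term `c` (tip `z`, raw-good at scale `k`,
`TrapRawOK`) is given a FENCE STOPPED AT `S ⊇ c` (`S` = the term together with the two arms):

* `fenceSet M c z k ω S` — the admissible sites of the connection: open sites of the fence zone
  off `S`, inside `Λ_{2M}` in `above c z`, outside `Λ_{2M}` strictly above the row of `z`;
  `mem_fenceSet_inside`, `mem_fenceSet_outside`, `fenceSet_subset`, `fenceSet_disjoint`;
* `TermFence M c z k ω S` — the data: the exterior fence site `m` on an open vertical crossing of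
  the corner box, the attachment `q ∈ S`, its neighbour `p`, and a tight open connection `F ⊆
  fenceSet` from `p` to `m`; `TrapRawOK.nonempty_termFence` (existence from raw success,
  `trap_exists_fence_gen`);
* the planar position of the connection: `TermFence.not_mem_of_subset_below` (it avoids every set
  below `c`, e.g. the earlier terms), `TrapRawOK.not_box3_of_offLower` /
  `TrapRawOK.not_box17_of_offLower` (the exclusion rings: an open set off `lower c z` reaching far
  does not enter the `3k`- / `17k`-box — e.g. the later terms and their tips),
  `TermFence.exists_exit` (following the connection from an inside site to its first exit from
  `Λ_{2M}`), `TermFence.not_mem_above_of_row_lt` (**F-low**: the connection of a term does not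
  enter `above c'` for a crossing `c'` it avoids whose tip is more than `2k + 1` rows higher — the
  exit site would be a top-type boundary site for `c'`, above the row of its tip).

Everything here is proved; no named facts are introduced.

## References

* P. Nolin, Near-critical percolation in two dimensions, *Electron. J. Probab.* 13 (2008), §4.4,
  proof of Lemma 15 (arXiv 0711.4948: Lemma 14) [Nolin2008].
* H. Kesten, Scaling relations for 2D-percolation, *Comm. Math. Phys.* 109 (1987), Lemma 2
  [Kesten1987].

Tree: `TrapRawOK` and its consequences (`ArmSeparationRawGood.lean`), `trapFrameZone`,
`OpenVCrossThrough` (`ArmSeparationFrame.lean`), `sType_or_nType`, `row_lt_of_nType`,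
`triNorm_eq_of_adj_exterior`, `mem_trapD_of_triNorm_le`, `trapO_coord` (`ArmSeparationTrapezoid.lean`),
`JDomain.mem_above_of_pathIn'`, `IsCrossing.not_mem_above_of_mem_Bt_union`,
`JDomain.mem_below`, `PathIn.exit`, `PathIn.exists_support`.
-/

noncomputable section

open Set

namespace Literature.Probability.Percolation

open LatticeModels

/-! ### The admissible sites of a stopped fence -/

/-- **The admissible sites of the connection of the fence of `c` (tip `z`, scale `k`) stopped at
`S`**: open sites of the fence zone off `S`, in `above c z` when inside `Λ_{2M}`, strictly above
the row of `z` when outside. [cite: Nolin2008, §4.4 Lemma 15 (proof) (arXiv 0711.4948: Lemma 14)] -/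
def fenceSet (M : ℕ) (c : Finset (Site 2)) (z : Site 2) (k : ℕ) (ω : SiteConfig (Site 2)) (S : Set (Site 2)) :
    Set (Site 2) :=
  (trapFrameZone M z k ∩
    {v | (triNorm v ≤ 2 * M → v ∈ (trapDomain M).above c z) ∧ (2 * (M : ℤ) < triNorm v → z 1 < v 1)}) ∩ ω ∩ Sᶜ

section FenceSet

variable {M k : ℕ} {c : Finset (Site 2)} {z : Site 2} {ω : SiteConfig (Site 2)} {S : Set (Site 2)} {v : Site 2}

/-- Sites of the fence set are open. [folklore] -/
theorem fenceSet_subset : fenceSet M c z k ω S ⊆ ω := fun _ hv => hv.1.2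

/-- Sites of the fence set are off `S`. [folklore] -/
theorem fenceSet_disjoint (hv : v ∈ fenceSet M c z k ω S) : v ∉ S := hv.2

/-- Sites of the fence set lie in the square of half-width `2k + 1` about `z`. [folklore] -/
theorem fenceSet_box (hv : v ∈ fenceSet M c z k ω S) :
    z 0 - (2 * k + 1) ≤ v 0 ∧ v 0 ≤ z 0 + (2 * k + 1) ∧ z 1 - (2 * k + 1) ≤ v 1 ∧ v 1 ≤ z 1 + (2 * k + 1) :=
  (mem_trapFrameZone.1 hv.1.1.1).2

/-- An inside site of the fence set is a site of the trapezoid above `c`, off `c`. [folklore] -/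
theorem mem_fenceSet_inside (hv : v ∈ fenceSet M c z k ω S) (hn : triNorm v ≤ 2 * M) :
    v ∈ trapD M ∧ v ∈ (trapDomain M).above c z ∧ v ∉ c := by
  have ha := hv.1.1.2.1 hn
  have hT : v ∈ trapD M := by
    rcases (mem_trapFrameZone.1 hv.1.1.1).1 with h | h
    · exact h
    · omega
  exact ⟨hT, ha, fun hvc => JDomain.not_mem_of_mem_above ha hvc⟩

/-- An outside site of the fence set lies strictly above the row of `z`. [folklore] -/
theorem mem_fenceSet_outside (hv : v ∈ fenceSet M c z k ω S) (hn : 2 * (M : ℤ) < triNorm v) : z 1 < v 1 :=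
  hv.1.1.2.2 hn

end FenceSet

/-! ### The data of a stopped fence -/

/-- **A fence of the term `c` (tip `z`, scale `k`) stopped at `S`** in `ω`: an exterior site `m`
on an open vertical crossing of the corner box `[z₀+k, z₀+2k] × [z₁+k, z₁+2k]`, an attachment
site `q ∈ S` with a neighbour `p`, and a tight open connection `F ⊆ fenceSet M c z k ω S` from `p`
to `m`. [cite: Nolin2008, §4.4 Lemma 15 (proof) (arXiv 0711.4948: Lemma 14)] [cite: Kesten1987, Lemma 2] -/
structure TermFence (M : ℕ) (c : Finset (Site 2)) (z : Site 2) (k : ℕ) (ω : SiteConfig (Site 2)) (S : Set (Site 2)) where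
  /-- the exterior fence site -/
  m : Site 2
  /-- the attachment site, in `S` -/
  q : Site 2
  /-- the first site of the connection, a neighbour of `q` -/
  p : Site 2
  /-- the sites of the connection -/
  F : Set (Site 2)
  vcross : OpenVCrossThrough (triStrip (z 0 + k) (z 1 + k) k k) (z 1 + k) (z 1 + 2 * k) ω m
  q_mem : q ∈ S
  adj : triGraph.Adj q p
  F_subset : F ⊆ fenceSet M c z k ω S
  path : PathIn triGraph F p m
  tight : ∀ x ∈ F, PathIn triGraph F p x

namespace TermFence

variable {M k : ℕ} {c : Finset (Site 2)} {z : Site 2} {ω : SiteConfig (Site 2)} {S : Set (Site 2)}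
  (T : TermFence M c z k ω S)

/-- `p ∈ F`. [folklore] -/
theorem p_mem : T.p ∈ T.F := T.path.left_mem

/-- `m ∈ F`. [folklore] -/
theorem m_mem : T.m ∈ T.F := T.path.right_mem

/-- Every site of the connection is joined to `m` inside it. [folklore] -/
theorem pathIn_to_m {x : Site 2} (hx : x ∈ T.F) : PathIn triGraph T.F x T.m := (T.tight x hx).symm.trans T.path

/-- The fence site is outside `Λ_{2M}` (it lies in the corner box, `1 ≤ k`). [folklore] -/
theorem norm_m (hk : 1 ≤ k) (hz : z ∈ trapO M) : 2 * (M : ℤ) < triNorm T.m := by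
  obtain ⟨e₁, e₂, -, -, hp, -⟩ := T.vcross
  have hm := (hp.right_mem).1
  rw [mem_triStrip] at hm
  have hz' := trapO_coord hz
  have hk' : (1 : ℤ) ≤ k := by exact_mod_cast hk
  rw [triNorm_eq_max]; simp only [lt_max_iff]; omega

/-- **The connection avoids every set below `c`** (inside sites are above `c`; outside sites are
not in the trapezoid). [folklore] -/
theorem not_mem_of_subset_below {c' : Finset (Site 2)} (hc' : c' ⊆ (trapDomain M).below c z) {x : Site 2}
    (hx : x ∈ T.F) : x ∉ c' := by
  intro hxc'
  have hb := JDomain.mem_below.1 (hc' hxc')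
  by_cases hn : triNorm x ≤ 2 * M
  · exact hb.2.2 (mem_fenceSet_inside (T.F_subset hx) hn).2.1
  · have := (mem_trapD_iff_triNorm.1 hb.1).2
    omega

/-- **Following the connection out of `Λ_{2M}`**: from an inside site `x ∈ F`, the connection
(which ends at the exterior site `m`) reaches a last inside site `x'` adjacent to an exterior site
`e ∈ F`, through inside sites of `F` only. [folklore] -/
theorem exists_exit (hk : 1 ≤ k) (hz : z ∈ trapO M) {x : Site 2} (hx : x ∈ T.F) (hxn : triNorm x ≤ 2 * M) :
    ∃ x' e : Site 2, triNorm x' ≤ 2 * M ∧ 2 * (M : ℤ) < triNorm e ∧ e ∈ T.F ∧ triGraph.Adj x' e ∧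
      PathIn triGraph ({v | triNorm v ≤ 2 * M} ∩ T.F) x x' := by
  have hm := T.norm_m hk hz
  obtain ⟨x', e, hx', he, heF, hadj, hpath⟩ :=
    (T.pathIn_to_m hx).exit (R := {v : Site 2 | triNorm v ≤ 2 * M}) hxn (by simp only [Set.mem_setOf_eq, not_le]; exact hm)
  simp only [Set.mem_setOf_eq, not_le] at hx' he
  exact ⟨x', e, hx', he, heF, hadj, hpath⟩

/-- **F-low: the connection of a term does not enter `above c'` for a higher crossing `c'` it
avoids.** Let `c'` be a crossing of `trapDomain M` with tip `z'` more than `2k + 1` rows above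
`z`, avoided by the connection `F`. Then no inside site of `F` lies in `above c' z'`: following `F`
to its first exit from `Λ_{2M}`, the last inside site would be a boundary site of the trapezoid in
`above c'`, hence top-type for `z'` (`sType_or_nType`, `not_mem_above_of_mem_Bt_union`), hence
strictly above the row of `z'` (`row_lt_of_nType`) — but `F` stays within `2k + 1` rows of `z`. [cite: Nolin2008, §4.4 Lemma 15 (proof) (arXiv 0711.4948: Lemma 14)] -/
theorem not_mem_above_of_row_lt (hk : 1 ≤ k) (hz : z ∈ trapO M) {c' : Finset (Site 2)} {z' : Site 2}
    (hc' : (trapDomain M).IsCrossing c' z') (hrow : z 1 + (2 * k + 1) < z' 1) (hdisj : ∀ v ∈ T.F, v ∉ c')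
    {x : Site 2} (hx : x ∈ T.F) (hxn : triNorm x ≤ 2 * M) : x ∉ (trapDomain M).above c' z' := by
  intro hxa
  have hcut := trapDomain_cutProp M
  have hz'O : z' ∈ trapO M := tip_mem_trapO hc'
  obtain ⟨x', e, hx'n, hen, -, hadj, hpath⟩ := T.exists_exit hk hz hx hxn
  -- the inside stretch runs in `D ∖ c'`, so `x'` is above `c'`
  have hsub : {v | triNorm v ≤ 2 * M} ∩ T.F ⊆ (↑((trapDomain M).D \ c') : Set (Site 2)) := by
    rintro v ⟨hvn, hvF⟩
    rw [Finset.coe_sdiff]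
    exact ⟨(mem_fenceSet_inside (T.F_subset hvF) hvn).1, fun h => hdisj v hvF h⟩
  have hx'F : x' ∈ T.F := hpath.right_mem.2
  have hx'a : x' ∈ (trapDomain M).above c' z' := JDomain.mem_above_of_pathIn' hxa (hpath.mono hsub)
  have hx'T : x' ∈ trapD M := (mem_fenceSet_inside (T.F_subset hx'F) hx'n).1
  have hx'b : triNorm x' = 2 * M := triNorm_eq_of_adj_exterior hx'T hen hadj
  have hne : x' ≠ z' := fun h => hdisj x' hx'F (h ▸ hc'.tip_mem)
  rcases sType_or_nType hx'T hx'b hz'O hne with hS | hN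
  · exact hc'.not_mem_above_of_mem_Bt_union hcut hS hx'a
  · have h1 := row_lt_of_nType hz'O hN hne
    have h2 := (fenceSet_box (T.F_subset hx'F)).2.2.2
    omega

end TermFence

/-! ### Existence from raw success; the rings -/

namespace TrapRawOK

variable {M k : ℕ} {c : Finset (Site 2)} {z : Site 2} {ω : SiteConfig (Site 2)}

/-- **A raw-good term has a fence stopped at any `S ⊇ c` inside `Λ_{2M}`** (`1 ≤ k`,
`2k + 1 ≤ M`). [cite: Nolin2008, §4.4 Lemma 15 (proof) (arXiv 0711.4948: Lemma 14)] [cite: Kesten1987, Lemma 2] -/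
theorem nonempty_termFence (h : TrapRawOK M c z k ω) (hk : 1 ≤ k) (hkM : 2 * (k : ℤ) + 1 ≤ M)
    (hc : (trapDomain M).IsCrossing c z) {S : Set (Site 2)} (hcS : (↑c : Set (Site 2)) ⊆ S)
    (hSn : ∀ v ∈ S, triNorm v ≤ 2 * M) : Nonempty (TermFence M c z k ω S) := by
  obtain ⟨m, hV, q, hqS, p, hqp, hpath⟩ := h.exists_fence_gen hk hkM hc hcS hSn
  obtain ⟨F, hF, hp, ht⟩ := hpath.exists_support
  exact ⟨{ m := m, q := q, p := p, F := F, vcross := hV, q_mem := hqS, adj := hqp, F_subset := hF,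
           path := hp, tight := ht }⟩

/-- **Inner ring, box form**: an open set off `lower c z` joining `x` to a site `t` outside the
`7k`-box about `z` does not contain `x` in the `3k`-box (`1 ≤ k`). [cite: Nolin2008, §4.4 Lemma 15 (proof) (arXiv 0711.4948: Lemma 14)] -/
theorem not_box3_of_offLower (h : TrapRawOK M c z k ω) (hk : 1 ≤ k) {A : Set (Site 2)}
    (hA : A ⊆ ((↑((trapDomain M).lower c z) : Set (Site 2))ᶜ ∩ ω)) {x t : Site 2} (hp : PathIn triGraph A x t)
    (ht : t 0 ≤ z 0 - 7 * k ∨ z 0 + 7 * k ≤ t 0 ∨ t 1 ≤ z 1 - 7 * k ∨ z 1 + 7 * k ≤ t 1) :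
    ¬ (z 0 - 3 * k ≤ x 0 ∧ x 0 ≤ z 0 + 3 * k ∧ z 1 - 3 * k ≤ x 1 ∧ x 1 ≤ z 1 + 3 * k) :=
  fun hx => h.inner_ring hk hx ht (hp.mono hA)

/-- **Outer ring, box form**: an open set off `lower c z` joining `x` to a site `t` outside the
`31k`-box about `z` does not contain `x` in the `17k`-box (`1 ≤ k`). [cite: Nolin2008, §4.4 Lemma 15 (proof) (arXiv 0711.4948: Lemma 14)] -/
theorem not_box17_of_offLower (h : TrapRawOK M c z k ω) (hk : 1 ≤ k) {A : Set (Site 2)}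
    (hA : A ⊆ ((↑((trapDomain M).lower c z) : Set (Site 2))ᶜ ∩ ω)) {x t : Site 2} (hp : PathIn triGraph A x t)
    (ht : t 0 ≤ z 0 - 31 * k ∨ z 0 + 31 * k ≤ t 0 ∨ t 1 ≤ z 1 - 31 * k ∨ z 1 + 31 * k ≤ t 1) :
    ¬ (z 0 - 17 * k ≤ x 0 ∧ x 0 ≤ z 0 + 17 * k ∧ z 1 - 17 * k ≤ x 1 ∧ x 1 ≤ z 1 + 17 * k) :=
  fun hx => h.outer_ring hk hx ht (hp.mono hA)

/-- **A higher open crossing off `lower c z` has its tip more than `17k` rows above `z`**: if `c'`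
(tip `z'`, higher than `z`) is open, lies off `lower c z`, and `31k + 1 ≤ M`, then
`z 1 + 17k < z' 1` (the outer ring; `c'` joins `z'` to `trapI`, outside the `31k`-box). [cite: Nolin2008, §4.4 Lemma 15 (proof) (arXiv 0711.4948: Lemma 14)] -/
theorem row_gap (h : TrapRawOK M c z k ω) (hk : 1 ≤ k) (hkM : 31 * (k : ℤ) + 1 ≤ M)
    (hc : (trapDomain M).IsCrossing c z) {c' : Finset (Site 2)} {z' : Site 2}
    (hc' : (trapDomain M).IsCrossing c' z') (hc'ω : (↑c' : Set (Site 2)) ⊆ ω)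
    (hoff : ∀ v ∈ c', v ∉ (trapDomain M).lower c z) (hlt : z 1 < z' 1) : z 1 + 17 * k < z' 1 := by
  obtain ⟨f, hfc', hfI⟩ := hc'.exists_start
  have hzO := tip_mem_trapO hc
  have hz'O := tip_mem_trapO hc'
  have hz := trapO_coord hzO
  have hz' := trapO_coord hz'O
  have hf0 := (mem_trapI.1 hfI).2
  have hA : (↑c' : Set (Site 2)) ⊆ ((↑((trapDomain M).lower c z) : Set (Site 2))ᶜ ∩ ω) :=
    fun v hv => ⟨fun h => hoff v (Finset.mem_coe.1 hv) (Finset.mem_coe.1 h), hc'ω hv⟩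
  have hnot := h.not_box17_of_offLower hk hA (hc'.conn z' hc'.tip_mem f hfc') (Or.inl (by omega))
  by_contra hle
  exact hnot ⟨by omega, by omega, by omega, by omega⟩

/-- **A higher open connected set off `lower c z` reaching far avoids the `3k`-box**: inner ring
form used for later terms and for pieces of arms above `c`. [cite: Nolin2008, §4.4 Lemma 15 (proof) (arXiv 0711.4948: Lemma 14)] -/
theorem not_box3_of_crossing (h : TrapRawOK M c z k ω) (hk : 1 ≤ k) (hkM : 7 * (k : ℤ) + 1 ≤ M)
    (hc : (trapDomain M).IsCrossing c z) {c' : Finset (Site 2)} {z' : Site 2}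
    (hc' : (trapDomain M).IsCrossing c' z') (hc'ω : (↑c' : Set (Site 2)) ⊆ ω)
    (hoff : ∀ v ∈ c', v ∉ (trapDomain M).lower c z) {x : Site 2} (hx : x ∈ c') :
    ¬ (z 0 - 3 * k ≤ x 0 ∧ x 0 ≤ z 0 + 3 * k ∧ z 1 - 3 * k ≤ x 1 ∧ x 1 ≤ z 1 + 3 * k) := by
  obtain ⟨f, hfc', hfI⟩ := hc'.exists_start
  have hz := trapO_coord (tip_mem_trapO hc)
  have hf0 := (mem_trapI.1 hfI).2
  have hA : (↑c' : Set (Site 2)) ⊆ ((↑((trapDomain M).lower c z) : Set (Site 2))ᶜ ∩ ω) :=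
    fun v hv => ⟨fun h => hoff v (Finset.mem_coe.1 hv) (Finset.mem_coe.1 h), hc'ω hv⟩
  exact h.not_box3_of_offLower hk hA (hc'.conn x hx f hfc') (Or.inl (by omega))

end TrapRawOK

/-- **The connection of a term avoids a higher crossing off `lower c z`** (`7k + 1 ≤ M`): the
inside sites of `fenceSet` lie in the `(2k+1)`-box, inside the `3k`-box for `k ≥ 1`. [cite: Nolin2008, §4.4 Lemma 15 (proof) (arXiv 0711.4948: Lemma 14)] -/
theorem TermFence.not_mem_of_offLower {M k : ℕ} {c : Finset (Site 2)} {z : Site 2} {ω : SiteConfig (Site 2)}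
    {S : Set (Site 2)} (T : TermFence M c z k ω S) (h : TrapRawOK M c z k ω) (hk : 1 ≤ k)
    (hkM : 7 * (k : ℤ) + 1 ≤ M) (hc : (trapDomain M).IsCrossing c z) {c' : Finset (Site 2)} {z' : Site 2}
    (hc' : (trapDomain M).IsCrossing c' z') (hc'ω : (↑c' : Set (Site 2)) ⊆ ω)
    (hoff : ∀ v ∈ c', v ∉ (trapDomain M).lower c z) {x : Site 2} (hx : x ∈ T.F) : x ∉ c' := by
  intro hxc'
  have hb := fenceSet_box (T.F_subset hx)
  exact h.not_box3_of_crossing hk hkM hc hc' hc'ω hoff hxc' ⟨by omega, by omega, by omega, by omega⟩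

end Literature.Probability.Percolation
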